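import Literature.Analysis.FunctionSpaces.BMOCarlesonConverse
import Literature.Analysis.FunctionSpaces.LittlewoodPaley
import Literature.Analysis.Fourier.LpMultiplierDilation
import Mathlib.Analysis.Fourier.Convolution
import Mathlib.Analysis.Fourier.Inversion
import HarnessLib

/-!
# Smoothed low-frequency cancellation for the Gauss–Weierstrass kernel

Analysis/UnboundedOperators support file (all results proved; no definitions, no named facts).
It serves the discharge of the Bernstein-type bound
`Literature.Analysis.FluidPDE.Torus.rieszPotential_Lp_bound_of_freqSupport`
(`FluidPDE/TorusLpOperatorFacts`; Buckmaster–Vicol, Ann. of Math. 189 (2019), App. B, proof of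
Lemma B.1: "`‖|∇|⁻¹ P_{≥κ/2}‖_{L^p→L^p} ≲ 1/κ`, which is a direct consequence of the
Littlewood–Paley decomposition"), whose proof in the tree runs through the heat semigroup
`|∇|⁻¹ = π^{-1/2} ∫₀^∞ t^{-1/2} e^{tΔ} dt` instead of a Littlewood–Paley square function.

Let `K_t = heatKernel t` be the Gauss–Weierstrass kernel of a finite-dimensional real inner
product space `E` (`d = dim E`). We prove:

* `lintegral_enorm_heatKernel_add_add_sub_sub_le` — the **second-order translation modulus**
  `‖K_t(· + a) + K_t(· - a) - 2K_t‖_{L¹} ≤ ‖a‖² (2^{d/2}(t/2)^{-1/2})²` (one fundamental theorem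
  of calculus along the segment on top of the tree's first-order modulus of `∇K_t`,
  `BMOInv.lintegral_enorm_heatKernelGrad_add_sub_le`);
* `lintegral_enorm_heatKernel_sub_convolution_le` — the **smoothed cancellation**: for an even
  `Ψ ∈ L¹(E)` with `∫ Ψ = 1` and finite second moment,
  `‖K_t - Ψ ⋆ K_t‖_{L¹} ≤ 2^d t⁻¹ ∫ ‖y‖² |Ψ(y)| dy`
  (`K_t - Ψ ⋆ K_t = -½ ∫ Ψ(y) (K_t(·+y) + K_t(·-y) - 2K_t) dy` by evenness);
* `exists_lowFreq_mollifier` — for every `κ > 0` an even real Schwartz mollifier `Ψ` with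
  `∫ Ψ = 1`, `∫ ‖y‖²|Ψ| ≤ M (2/κ)²` and `𝓕Ψ = 0` on `{‖ξ‖ ≥ κ}`, namely `Ψ = Re 𝓕⁻[χ(2ξ/κ)]`
  with `χ = FunctionSpaces.dyadicCutoff E` (Mathlib's bump, `= 1` on the unit ball, `= 0` outside
  the ball of radius `2`); the second-moment scaling is
  `integral_norm_sq_mul_abs_re_fourierInv_dyadicCutoff_smul`;
* `exists_heatKernel_lowFreq_cancellation` — the package consumed on the torus: a constant
  `C = C(d)` and, for every `κ > 0`, a `Ψ ∈ L¹` with `𝓕(Ψ ⋆ K_t) = 0` on `{‖ξ‖ ≥ κ}` and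
  `‖K_t - Ψ ⋆ K_t‖_{L¹} ≤ C/(κ²t)` for all `t > 0`. On data with spectrum in `{‖ξ‖ ≥ κ}` the
  heat semigroup therefore acts through a kernel of `L¹` norm `min(1, C/(κ²t))`, and
  `π^{-1/2}∫₀^∞ t^{-1/2} min(1, C/(κ²t)) dt = O(κ⁻¹)`.

## Mathlib / tree search

Mathlib: `Real.fourier_smul_convolution_eq` (Fourier transform of a convolution),
`Continuous.fourier_fourierInv_eq`, `Real.fourierInv_eq_fourier_neg`,
`Real.fourierInv_eq_fourier_comp_neg`, `HasCompactSupport.toSchwartzMap`,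
`SchwartzMap.integrable_pow_mul`, `Measure.integral_comp_smul`, `ContDiffBump.neg`; no heat
kernel. Tree (all reused): `heatKernel`, `integrable_heatKernel_holds`, `heatKernel_le`
(`UnboundedOperators/HeatKernel`); `BMOInv.heatKernelGrad`, `hasDerivAt_heatKernel_segment`,
`lintegral_enorm_heatKernelGrad_add_sub_le` (`FunctionSpaces/BMOCarleson*`);
`FunctionSpaces.dyadicCutoff`, `contDiff_ofReal_dyadicCutoff_smul`,
`hasCompactSupport_ofReal_dyadicCutoff_smul` (`FunctionSpaces/LittlewoodPaley`);
`Fourier.fourierInv_comp_smul` (`Analysis/Fourier/LpMultiplierDilation`). Nothing in Mathlib or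
the tree on moment/cancellation bounds for `K_t - Ψ ⋆ K_t`
(`lean search 'heatKernel.*convolution.*sub|sub_convolution'`).

## References

* T. Buckmaster, V. Vicol, *Nonuniqueness of weak solutions to the Navier–Stokes equation*,
  Ann. of Math. 189 (2019) = arXiv:1709.10033, App. B, proof of Lemma B.1 (consumer).
  [`BuckmasterVicol2019AnnMath`]
* E. M. Stein, *Singular Integrals and Differentiability Properties of Functions* (1970),
  Ch. III §2 (the Gauss–Weierstrass semigroup), Ch. V §3.2 (`|∇|^{-α}` by subordination).
  [`SteinSingularIntegrals1970`]
* L. Grafakos, *Classical Fourier Analysis*, 3rd ed. (2014), Thm. 1.2.10 (Young), §5.1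
  (Bernstein-type multipliers). [`Grafakos2014`]
-/

noncomputable section

open MeasureTheory Filter Set Function
open scoped ENNReal NNReal RealInnerProductSpace Convolution FourierTransform Topology

namespace Literature.Analysis.UnboundedOperators

open Literature.Analysis.FunctionSpaces.BMOInv

variable {E : Type*} [NormedAddCommGroup E] [InnerProductSpace ℝ E] [FiniteDimensional ℝ E]
  [MeasurableSpace E] [BorelSpace E]

/-! ## Second-order translation modulus of the heat kernel in `L¹` -/

/-- **Second-order translation modulus of the heat kernel in `L¹`**:
`∫ |K_τ(v + a) + K_τ(v - a) - 2 K_τ(v)| dv ≤ ‖a‖² (2^{d/2} (τ/2)^{-1/2})²` — one more fundamental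
theorem of calculus along the segment on top of the first-order modulus of `∇K_τ`
(`BMOInv.lintegral_enorm_heatKernelGrad_add_sub_le`). [folklore] -/
theorem lintegral_enorm_heatKernel_add_add_sub_sub_le {τ : ℝ} (hτ : 0 < τ) (a : E) :
    ∫⁻ v, ‖heatKernel τ (v + a) + heatKernel τ (v - a) - 2 * heatKernel τ v‖ₑ ≤
      ENNReal.ofReal (‖a‖ ^ 2 *
        ((2 : ℝ) ^ ((Module.finrank ℝ E : ℝ) / 2) * (Real.sqrt (τ / 2))⁻¹) ^ 2) := by
  set A : ℝ := (2 : ℝ) ^ ((Module.finrank ℝ E : ℝ) / 2) * (Real.sqrt (τ / 2))⁻¹ with hA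
  have hGc := continuous_heatKernelGrad (E := E) τ
  -- first-order fundamental theorem of calculus along the segment
  have hFTC : ∀ w : E, heatKernel τ (w + a) - heatKernel τ w =
      ∫ θ in (0 : ℝ)..1, ⟪heatKernelGrad τ (w + θ • a), a⟫ := by
    intro w
    have hcont : Continuous fun θ : ℝ => ⟪heatKernelGrad τ (w + θ • a), a⟫ := by fun_prop
    have h := intervalIntegral.integral_eq_sub_of_hasDerivAt
      (fun θ _ => hasDerivAt_heatKernel_segment τ w a θ) (hcont.intervalIntegrable 0 1)
    simp only [one_smul, zero_smul, add_zero] at h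
    exact h.symm
  have hpt : ∀ v : E, ‖heatKernel τ (v + a) + heatKernel τ (v - a) - 2 * heatKernel τ v‖ₑ ≤
      ∫⁻ θ in Ioc (0 : ℝ) 1,
        ‖heatKernelGrad τ (v + θ • a) - heatKernelGrad τ (v - a + θ • a)‖ₑ * ‖a‖ₑ := by
    intro v
    have h1 := hFTC v
    have h2 := hFTC (v - a)
    rw [sub_add_cancel] at h2
    have hc1 : Continuous fun θ : ℝ => ⟪heatKernelGrad τ (v + θ • a), a⟫ := by fun_prop
    have hc2 : Continuous fun θ : ℝ => ⟪heatKernelGrad τ (v - a + θ • a), a⟫ := by fun_prop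
    have heq : heatKernel τ (v + a) + heatKernel τ (v - a) - 2 * heatKernel τ v =
        ∫ θ in (0 : ℝ)..1, ⟪heatKernelGrad τ (v + θ • a) - heatKernelGrad τ (v - a + θ • a), a⟫ := by
      have : heatKernel τ (v + a) + heatKernel τ (v - a) - 2 * heatKernel τ v =
          (heatKernel τ (v + a) - heatKernel τ v) - (heatKernel τ v - heatKernel τ (v - a)) := by ring
      rw [this, h1, h2, ← intervalIntegral.integral_sub (hc1.intervalIntegrable 0 1)
        (hc2.intervalIntegrable 0 1)]
      refine intervalIntegral.integral_congr fun θ _ => ?_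
      simp only [inner_sub_left]
    rw [heq, intervalIntegral.integral_of_le zero_le_one]
    calc ‖∫ θ in Ioc (0 : ℝ) 1,
          ⟪heatKernelGrad τ (v + θ • a) - heatKernelGrad τ (v - a + θ • a), a⟫‖ₑ
        ≤ ∫⁻ θ in Ioc (0 : ℝ) 1,
          ‖⟪heatKernelGrad τ (v + θ • a) - heatKernelGrad τ (v - a + θ • a), a⟫‖ₑ :=
          enorm_integral_le_lintegral_enorm _
      _ ≤ _ := lintegral_mono fun θ => by
          rw [← ofReal_norm, ← ofReal_norm, ← ofReal_norm, ← ENNReal.ofReal_mul (norm_nonneg _)]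
          exact ENNReal.ofReal_le_ofReal (norm_inner_le_norm _ _)
  have hmeas : Measurable fun q : E × ℝ =>
      ‖heatKernelGrad τ (q.1 + q.2 • a) - heatKernelGrad τ (q.1 - a + q.2 • a)‖ₑ * ‖a‖ₑ := by
    have h1 : Continuous fun q : E × ℝ =>
        heatKernelGrad τ (q.1 + q.2 • a) - heatKernelGrad τ (q.1 - a + q.2 • a) := by fun_prop
    exact h1.measurable.enorm.mul_const _
  calc ∫⁻ v, ‖heatKernel τ (v + a) + heatKernel τ (v - a) - 2 * heatKernel τ v‖ₑ
      ≤ ∫⁻ v, ∫⁻ θ in Ioc (0 : ℝ) 1,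
          ‖heatKernelGrad τ (v + θ • a) - heatKernelGrad τ (v - a + θ • a)‖ₑ * ‖a‖ₑ :=
        lintegral_mono hpt
    _ = ∫⁻ θ in Ioc (0 : ℝ) 1, ∫⁻ v,
          ‖heatKernelGrad τ (v + θ • a) - heatKernelGrad τ (v - a + θ • a)‖ₑ * ‖a‖ₑ :=
        lintegral_lintegral_swap hmeas.aemeasurable
    _ = ∫⁻ θ in Ioc (0 : ℝ) 1,
          (∫⁻ v, ‖heatKernelGrad τ (v + a) - heatKernelGrad τ v‖ₑ ∂(volume : Measure E)) * ‖a‖ₑ := by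
        refine lintegral_congr fun θ => ?_
        have hmv : Measurable fun v : E =>
            ‖heatKernelGrad τ (v + θ • a) - heatKernelGrad τ (v - a + θ • a)‖ₑ := by
          have : Continuous fun v : E =>
              heatKernelGrad τ (v + θ • a) - heatKernelGrad τ (v - a + θ • a) := by fun_prop
          exact this.measurable.enorm
        rw [lintegral_mul_const _ hmv]
        congr 1
        rw [← lintegral_add_right_eq_self
          (fun v : E => ‖heatKernelGrad τ (v + a) - heatKernelGrad τ v‖ₑ) (θ • a - a)]
        refine lintegral_congr fun v => ?_
        rw [show v + (θ • a - a) + a = v + θ • a by abel,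
          show v + (θ • a - a) = v - a + θ • a by abel]
    _ ≤ ∫⁻ θ in Ioc (0 : ℝ) 1, ENNReal.ofReal (‖a‖ * A ^ 2) * ‖a‖ₑ := by
        refine lintegral_mono fun θ => ?_
        gcongr
        exact lintegral_enorm_heatKernelGrad_add_sub_le hτ a
    _ = ENNReal.ofReal (‖a‖ ^ 2 * A ^ 2) := by
        rw [setLIntegral_const, Real.volume_Ioc, sub_zero, ENNReal.ofReal_one, mul_one,
          ← ofReal_norm, ← ENNReal.ofReal_mul (by positivity)]
        congr 1
        ring


/-! ## Smoothed low-frequency cancellation: `‖K_t - Ψ ⋆ K_t‖₁ ≤ 2^d t⁻¹ ∫ ‖y‖² |Ψ(y)| dy` -/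

omit [FiniteDimensional ℝ E] [MeasurableSpace E] [BorelSpace E] in
/-- `((2^{d/2}) (√(t/2))⁻¹)² / 2 = 2^d / t`. [folklore] -/
theorem half_mul_modulusConst_sq {t : ℝ} (ht : 0 < t) :
    (1 / 2 : ℝ) * ((2 : ℝ) ^ ((Module.finrank ℝ E : ℝ) / 2) * (Real.sqrt (t / 2))⁻¹) ^ 2 =
      (2 : ℝ) ^ Module.finrank ℝ E * t⁻¹ := by
  have h2 : ((2 : ℝ) ^ ((Module.finrank ℝ E : ℝ) / 2)) ^ 2 = (2 : ℝ) ^ Module.finrank ℝ E := by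
    rw [← Real.rpow_natCast ((2 : ℝ) ^ ((Module.finrank ℝ E : ℝ) / 2)) 2, ← Real.rpow_mul zero_le_two,
      Nat.cast_ofNat, div_mul_cancel₀ _ two_ne_zero, Real.rpow_natCast]
  have hs : ((Real.sqrt (t / 2))⁻¹) ^ 2 = (t / 2)⁻¹ := by
    rw [inv_pow, Real.sq_sqrt (by positivity)]
  rw [mul_pow, h2, hs]
  field_simp

/-- **Smoothed low-frequency cancellation for the heat kernel.** If `Ψ ∈ L¹(E)` is even with
`∫ Ψ = 1` and finite second moment, then
`‖K_t - Ψ ⋆ K_t‖_{L¹} ≤ 2^d t⁻¹ ∫ ‖y‖² |Ψ(y)| dy` for every `t > 0`: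
`K_t - Ψ ⋆ K_t = -½ ∫ Ψ(y) (K_t(· + y) + K_t(· - y) - 2K_t) dy` by evenness, and the second-order
modulus `lintegral_enorm_heatKernel_add_add_sub_sub_le`. (The mechanism behind
"`‖|∇|⁻¹ P_{≥κ}‖_{L^p → L^p} ≲ κ⁻¹`": with `Ψ̂ = 1` near the origin the kernel `K_t - Ψ ⋆ K_t`
acts like `e^{tΔ}` on high frequencies but has `L¹` norm `O((κ²t)⁻¹)`.) [folklore] -/
theorem lintegral_enorm_heatKernel_sub_convolution_le {Ψ : E → ℝ} (hΨi : Integrable Ψ)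
    (hΨe : ∀ y, Ψ (-y) = Ψ y) (hΨ1 : ∫ y, Ψ y = 1)
    (hΨ2 : Integrable fun y => ‖y‖ ^ 2 * Ψ y) {t : ℝ} (ht : 0 < t) :
    ∫⁻ x, ‖heatKernel t x - (Ψ ⋆[ContinuousLinearMap.lsmul ℝ ℝ, volume] heatKernel t) x‖ₑ ≤
      ENNReal.ofReal ((2 : ℝ) ^ Module.finrank ℝ E * t⁻¹ * ∫ y, ‖y‖ ^ 2 * |Ψ y|) := by
  set A : ℝ := (2 : ℝ) ^ ((Module.finrank ℝ E : ℝ) / 2) * (Real.sqrt (t / 2))⁻¹ with hA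
  have hKc : Continuous (heatKernel (E := E) t) := continuous_heatKernel t
  have hKbdd : ∀ z : E, ‖heatKernel t z‖ ≤ (4 * Real.pi * t) ^ (-(Module.finrank ℝ E : ℝ) / 2) := by
    intro z
    rw [Real.norm_of_nonneg (heatKernel_pos ht z).le]
    exact heatKernel_le ht z
  -- the second difference `D x y = K(x + y) + K(x - y) - 2 K(x)`
  set D : E → E → ℝ := fun x y => heatKernel t (x + y) + heatKernel t (x - y) - 2 * heatKernel t x
    with hD
  -- integrability of the pieces
  have hint_sub : ∀ x : E, Integrable fun y => Ψ y * heatKernel t (x - y) := fun x =>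
    hΨi.mul_bdd (hKc.comp (continuous_const.sub continuous_id)).aestronglyMeasurable
      (Eventually.of_forall fun y => hKbdd _)
  have hint_add : ∀ x : E, Integrable fun y => Ψ y * heatKernel t (x + y) := fun x =>
    hΨi.mul_bdd (hKc.comp (continuous_const.add continuous_id)).aestronglyMeasurable
      (Eventually.of_forall fun y => hKbdd _)
  have hint_const : ∀ x : E, Integrable fun y => Ψ y * heatKernel t x := fun x => hΨi.mul_const _
  -- the representation `K x - (Ψ ⋆ K) x = -½ ∫ Ψ y * D x y`
  have hrepr : ∀ x : E, heatKernel t x - (Ψ ⋆[ContinuousLinearMap.lsmul ℝ ℝ, volume] heatKernel t) x =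
      -(1 / 2 : ℝ) * ∫ y, Ψ y * D x y := by
    intro x
    have hconv : (Ψ ⋆[ContinuousLinearMap.lsmul ℝ ℝ, volume] heatKernel t) x =
        ∫ y, Ψ y * heatKernel t (x - y) := by
      rw [convolution_lsmul]
      rfl
    have heven : ∫ y, Ψ y * heatKernel t (x + y) = ∫ y, Ψ y * heatKernel t (x - y) := by
      rw [← integral_neg_eq_self (fun y => Ψ y * heatKernel t (x + y)) volume]
      refine integral_congr_ae (Eventually.of_forall fun y => ?_)
      simp only [hΨe, ← sub_eq_add_neg]
    have hDint : ∫ y, Ψ y * D x y =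
        2 * (Ψ ⋆[ContinuousLinearMap.lsmul ℝ ℝ, volume] heatKernel t) x - 2 * heatKernel t x := by
      have hy : ∀ y, Ψ y * D x y = (Ψ y * heatKernel t (x + y) + Ψ y * heatKernel t (x - y)) -
          2 * (Ψ y * heatKernel t x) := by
        intro y
        simp only [hD]
        ring
      simp_rw [hy]
      have hI : Integrable (fun y => Ψ y * heatKernel t (x + y) + Ψ y * heatKernel t (x - y)) :=
        (hint_add x).add (hint_sub x)
      rw [integral_sub hI ((hint_const x).const_mul 2),
        integral_add (hint_add x) (hint_sub x), integral_const_mul, integral_mul_const, hΨ1, heven,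
        hconv]
      ring
    rw [hDint]
    ring
  -- pointwise bound
  have hpt : ∀ x : E, ‖heatKernel t x - (Ψ ⋆[ContinuousLinearMap.lsmul ℝ ℝ, volume] heatKernel t) x‖ₑ ≤
      ENNReal.ofReal (1 / 2) * ∫⁻ y, ‖Ψ y‖ₑ * ‖D x y‖ₑ := by
    intro x
    rw [hrepr x, enorm_mul, show ‖-(1 / 2 : ℝ)‖ₑ = ENNReal.ofReal (1 / 2) by
      rw [enorm_neg, Real.enorm_eq_ofReal (by norm_num)]]
    gcongr
    refine (enorm_integral_le_lintegral_enorm _).trans (lintegral_mono fun y => ?_)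
    rw [enorm_mul]
  -- measurability on the product
  have hDm : Measurable fun q : E × E => ‖D q.1 q.2‖ₑ := by
    have : Continuous fun q : E × E => D q.1 q.2 := by
      simp only [hD]
      fun_prop
    exact this.measurable.enorm
  have hmeas : AEMeasurable (fun q : E × E => ‖Ψ q.2‖ₑ * ‖D q.1 q.2‖ₑ) (volume.prod volume) :=
    hΨi.aestronglyMeasurable.aemeasurable.enorm.comp_snd.mul hDm.aemeasurable
  -- second moment as a lintegral
  have hM : ∫⁻ y, ‖Ψ y‖ₑ * ENNReal.ofReal (‖y‖ ^ 2) = ENNReal.ofReal (∫ y, ‖y‖ ^ 2 * |Ψ y|) := by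
    have hi : Integrable fun y => ‖y‖ ^ 2 * |Ψ y| := by
      refine hΨ2.norm.congr (Eventually.of_forall fun y => ?_)
      simp only [norm_mul, norm_pow, Real.norm_eq_abs, abs_norm]
    rw [ofReal_integral_eq_lintegral_ofReal hi (Eventually.of_forall fun y => by positivity)]
    refine lintegral_congr fun y => ?_
    rw [Real.enorm_eq_ofReal_abs, ← ENNReal.ofReal_mul (abs_nonneg _), mul_comm]
  calc ∫⁻ x, ‖heatKernel t x - (Ψ ⋆[ContinuousLinearMap.lsmul ℝ ℝ, volume] heatKernel t) x‖ₑ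
      ≤ ∫⁻ x, ENNReal.ofReal (1 / 2) * ∫⁻ y, ‖Ψ y‖ₑ * ‖D x y‖ₑ := lintegral_mono hpt
    _ = ENNReal.ofReal (1 / 2) * ∫⁻ y, ∫⁻ x, ‖Ψ y‖ₑ * ‖D x y‖ₑ := by
        rw [lintegral_const_mul'' _ (hmeas.lintegral_prod_right'), lintegral_lintegral_swap hmeas]
    _ = ENNReal.ofReal (1 / 2) * ∫⁻ y, ‖Ψ y‖ₑ * ∫⁻ x, ‖D x y‖ₑ := by
        congr 1
        refine lintegral_congr fun y => ?_
        rw [lintegral_const_mul'' _ ?_]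
        exact (hDm.comp (measurable_id.prodMk measurable_const)).aemeasurable
    _ ≤ ENNReal.ofReal (1 / 2) * ∫⁻ y, ‖Ψ y‖ₑ * ENNReal.ofReal (‖y‖ ^ 2 * A ^ 2) := by
        gcongr with y
        exact lintegral_enorm_heatKernel_add_add_sub_sub_le ht y
    _ = ENNReal.ofReal (1 / 2) * (ENNReal.ofReal (A ^ 2) * ∫⁻ y, ‖Ψ y‖ₑ * ENNReal.ofReal (‖y‖ ^ 2)) := by
        congr 1
        rw [← lintegral_const_mul'' _ ?_]
        · refine lintegral_congr fun y => ?_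
          rw [ENNReal.ofReal_mul (by positivity), mul_comm (ENNReal.ofReal (‖y‖ ^ 2)), ← mul_assoc,
            ← mul_assoc, mul_comm (ENNReal.ofReal (A ^ 2))]
        · exact hΨi.aestronglyMeasurable.aemeasurable.enorm.mul
            (continuous_norm.pow 2).measurable.ennreal_ofReal.aemeasurable
    _ = ENNReal.ofReal ((2 : ℝ) ^ Module.finrank ℝ E * t⁻¹ * ∫ y, ‖y‖ ^ 2 * |Ψ y|) := by
        rw [hM, ← mul_assoc, ← ENNReal.ofReal_mul (by norm_num), ← ENNReal.ofReal_mul (by positivity),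
          half_mul_modulusConst_sq ht]

/-! ## An even real Schwartz mollifier with Fourier transform supported in a ball

The low-frequency cut-off is `χ_c(ξ) = χ(c ξ)` with `χ = FunctionSpaces.dyadicCutoff E` (Mathlib's bump:
`χ = 1` on `‖ξ‖ ≤ 1`, `χ = 0` on `‖ξ‖ ≥ 2`), and the mollifier is `Φ_c = 𝓕⁻ χ_c`, a real, even
Schwartz function of integral `χ(0) = 1` with `𝓕 Φ_c = χ_c`; `c = 2/κ` kills all frequencies
`‖ξ‖ ≥ κ`. -/

open Literature.Analysis.FunctionSpaces (dyadicCutoff dyadicCutoff_apply_of_norm_le_one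
  dyadicCutoff_apply_of_two_le_norm contDiff_ofReal_dyadicCutoff_smul
  hasCompactSupport_ofReal_dyadicCutoff_smul)

/-- For a real-valued `f`, `conj (𝓕⁻ f (y)) = 𝓕 f (y)`. [folklore] -/
theorem conj_fourierInv_ofReal (f : E → ℝ) (y : E) :
    (starRingEnd ℂ) (𝓕⁻ (fun v => (f v : ℂ)) y) = 𝓕 (fun v => (f v : ℂ)) y := by
  rw [Real.fourierInv_eq, Real.fourier_eq, ← integral_conj]
  refine integral_congr_ae (Eventually.of_forall fun v => ?_)
  simp only [Circle.smul_def, smul_eq_mul, map_mul, Complex.conj_ofReal]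
  rw [← Circle.coe_inv_eq_conj, ← AddChar.map_neg_eq_inv]

/-- `𝓕 f (0) = ∫ f`. [folklore] -/
theorem fourier_apply_zero {F : Type*} [NormedAddCommGroup F] [NormedSpace ℂ F] (f : E → F) :
    𝓕 f 0 = ∫ v, f v := by
  simp [Real.fourier_eq]

omit [MeasurableSpace E] [BorelSpace E] in
/-- The rescaled cut-offs `ξ ↦ χ(cξ)` are even (Mathlib's bump is radial). [folklore] -/
theorem ofReal_dyadicCutoff_smul_neg (c : ℝ) (ξ : E) :
    ((dyadicCutoff E (c • -ξ) : ℝ) : ℂ) = ((dyadicCutoff E (c • ξ) : ℝ) : ℂ) := by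
  rw [smul_neg, (dyadicCutoff E).neg]

/-- `𝓕⁻ χ_c = 𝓕 χ_c` for the even cut-off `χ_c = χ(c ·)`. [folklore] -/
theorem fourierInv_ofReal_dyadicCutoff_smul_eq_fourier (c : ℝ) :
    𝓕⁻ (fun ξ : E => ((dyadicCutoff E (c • ξ) : ℝ) : ℂ)) =
      𝓕 (fun ξ : E => ((dyadicCutoff E (c • ξ) : ℝ) : ℂ)) := by
  rw [Real.fourierInv_eq_fourier_comp_neg]
  simp_rw [ofReal_dyadicCutoff_smul_neg]

/-- The mollifier `Φ_c = 𝓕⁻ χ_c` is even. [folklore] -/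
theorem fourierInv_ofReal_dyadicCutoff_smul_neg (c : ℝ) (y : E) :
    𝓕⁻ (fun ξ : E => ((dyadicCutoff E (c • ξ) : ℝ) : ℂ)) (-y) =
      𝓕⁻ (fun ξ : E => ((dyadicCutoff E (c • ξ) : ℝ) : ℂ)) y := by
  conv_rhs => rw [fourierInv_ofReal_dyadicCutoff_smul_eq_fourier]
  rw [Real.fourierInv_eq_fourier_neg, neg_neg]

/-- The mollifier `Φ_c = 𝓕⁻ χ_c` is real-valued. [folklore] -/
theorem conj_fourierInv_ofReal_dyadicCutoff_smul (c : ℝ) (y : E) :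
    (starRingEnd ℂ) (𝓕⁻ (fun ξ : E => ((dyadicCutoff E (c • ξ) : ℝ) : ℂ)) y) =
      𝓕⁻ (fun ξ : E => ((dyadicCutoff E (c • ξ) : ℝ) : ℂ)) y := by
  rw [conj_fourierInv_ofReal, ← fourierInv_ofReal_dyadicCutoff_smul_eq_fourier]

/-- The mollifier `Φ_c = 𝓕⁻ χ_c` equals (the complexification of) its real part. [folklore] -/
theorem ofReal_re_fourierInv_ofReal_dyadicCutoff_smul (c : ℝ) (y : E) :
    (((𝓕⁻ (fun ξ : E => ((dyadicCutoff E (c • ξ) : ℝ) : ℂ)) y).re : ℝ) : ℂ) =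
      𝓕⁻ (fun ξ : E => ((dyadicCutoff E (c • ξ) : ℝ) : ℂ)) y :=
  Complex.conj_eq_iff_re.1 (conj_fourierInv_ofReal_dyadicCutoff_smul c y)

/-- **Second-moment scaling**: `∫ ‖y‖² |Re Φ_c(y)| dy = c² ∫ ‖y‖² |Re Φ₁(y)| dy` for `c > 0`
(`Φ_c(y) = c^{-d} Φ₁(y/c)`). [folklore] -/
theorem integral_norm_sq_mul_abs_re_fourierInv_dyadicCutoff_smul {c : ℝ} (hc : 0 < c) :
    ∫ y, ‖y‖ ^ 2 * |(𝓕⁻ (fun ξ : E => ((dyadicCutoff E (c • ξ) : ℝ) : ℂ)) y).re| =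
      c ^ 2 * ∫ y, ‖y‖ ^ 2 * |(𝓕⁻ (fun ξ : E => ((dyadicCutoff E ξ : ℝ) : ℂ)) y).re| := by
  set χ₁ : E → ℂ := fun ξ => ((dyadicCutoff E ξ : ℝ) : ℂ) with hχ₁
  have hscale : ∀ y : E, 𝓕⁻ (fun ξ : E => ((dyadicCutoff E (c • ξ) : ℝ) : ℂ)) y =
      (c ^ Module.finrank ℝ E)⁻¹ • 𝓕⁻ χ₁ (c⁻¹ • y) := by
    intro y
    have h := congr_fun (Literature.Analysis.Fourier.fourierInv_comp_smul χ₁ hc.ne') y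
    rw [abs_of_pos (by positivity)] at h
    exact h
  set F : E → ℝ := fun z => ‖z‖ ^ 2 * |(𝓕⁻ χ₁ z).re| with hF
  have hpt : ∀ y : E, ‖y‖ ^ 2 * |(𝓕⁻ (fun ξ : E => ((dyadicCutoff E (c • ξ) : ℝ) : ℂ)) y).re| =
      ((c ^ Module.finrank ℝ E)⁻¹ * c ^ 2) * F (c⁻¹ • y) := by
    intro y
    rw [hscale y, Complex.smul_re, smul_eq_mul, abs_mul, abs_of_pos (by positivity), hF]
    simp only [norm_smul, norm_inv, Real.norm_eq_abs, abs_of_pos hc]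
    field_simp
  simp_rw [hpt]
  rw [integral_const_mul, Measure.integral_comp_smul volume F c⁻¹, inv_pow, inv_inv,
    abs_of_pos (by positivity), smul_eq_mul]
  field_simp

/-- **The low-frequency mollifier at scale `κ`.** For every `κ > 0` there is an even real
`Ψ ∈ L¹(E)` with `∫ Ψ = 1`, finite second moment `∫ ‖y‖² |Ψ| ≤ M (2/κ)²` (with `M` independent of
`κ`) and `𝓕 Ψ (ξ) = 0` for `‖ξ‖ ≥ κ`; namely `Ψ = Re 𝓕⁻[χ(2ξ/κ)]`. [folklore] -/
theorem exists_lowFreq_mollifier :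
    ∃ M : ℝ, 0 ≤ M ∧ ∀ κ : ℝ, 0 < κ → ∃ Ψ : E → ℝ, Continuous Ψ ∧ Integrable Ψ ∧
      (∀ y, Ψ (-y) = Ψ y) ∧ ∫ y, Ψ y = 1 ∧ Integrable (fun y => ‖y‖ ^ 2 * Ψ y) ∧
      ∫ y, ‖y‖ ^ 2 * |Ψ y| ≤ M * (2 / κ) ^ 2 ∧
      (Integrable fun y => (Ψ y : ℂ)) ∧
      ∀ ξ : E, κ ≤ ‖ξ‖ → 𝓕 (fun y => (Ψ y : ℂ)) ξ = 0 := by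
  set M : ℝ := ∫ y, ‖y‖ ^ 2 * |(𝓕⁻ (fun ξ : E => ((dyadicCutoff E ξ : ℝ) : ℂ)) y).re| with hM
  refine ⟨M, integral_nonneg fun y => by positivity, fun κ hκ => ?_⟩
  set c : ℝ := 2 / κ with hc
  have hc0 : 0 < c := by positivity
  set χc : E → ℂ := fun ξ => ((dyadicCutoff E (c • ξ) : ℝ) : ℂ) with hχc
  have hχc_cont : Continuous χc := (contDiff_ofReal_dyadicCutoff_smul c).continuous
  have hχc_supp : HasCompactSupport χc := hasCompactSupport_ofReal_dyadicCutoff_smul hc0.ne'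
  have hχc_int : Integrable χc := hχc_cont.integrable_of_hasCompactSupport hχc_supp
  set S : SchwartzMap E ℂ := hχc_supp.toSchwartzMap (contDiff_ofReal_dyadicCutoff_smul c) with hS
  have hScoe : (S : E → ℂ) = χc := rfl
  have hΦS : 𝓕⁻ χc = ⇑((𝓕⁻ S : SchwartzMap E ℂ)) := by rw [SchwartzMap.fourierInv_coe, hScoe]
  have hΦi : Integrable (𝓕⁻ χc) := by rw [hΦS]; exact (𝓕⁻ S : SchwartzMap E ℂ).integrable
  have hΦc : Continuous (𝓕⁻ χc) := by rw [hΦS]; exact (𝓕⁻ S : SchwartzMap E ℂ).continuous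
  have hΦ2 : Integrable (fun y => ‖y‖ ^ 2 * ‖𝓕⁻ χc y‖) := by
    rw [hΦS]; exact (𝓕⁻ S : SchwartzMap E ℂ).integrable_pow_mul volume 2
  have hFΦ : 𝓕 (𝓕⁻ χc) = χc := by
    refine hχc_cont.fourier_fourierInv_eq hχc_int ?_
    have h𝓕 : 𝓕 χc = ⇑((𝓕 S : SchwartzMap E ℂ)) := by rw [SchwartzMap.fourier_coe, hScoe]
    rw [h𝓕]
    exact (𝓕 S : SchwartzMap E ℂ).integrable
  -- the mollifier
  set Ψ : E → ℝ := fun y => (𝓕⁻ χc y).re with hΨ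
  have hΨC : ∀ y, ((Ψ y : ℝ) : ℂ) = 𝓕⁻ χc y := fun y => ofReal_re_fourierInv_ofReal_dyadicCutoff_smul c y
  have hΨC' : (fun y => ((Ψ y : ℝ) : ℂ)) = 𝓕⁻ χc := funext hΨC
  refine ⟨Ψ, Complex.continuous_re.comp hΦc, hΦi.re, fun y => ?_, ?_, ?_, ?_, ?_, fun ξ hξ => ?_⟩
  · simp only [hΨ, hχc, fourierInv_ofReal_dyadicCutoff_smul_neg]
  · have h := integral_re hΦi
    simp only [RCLike.re_to_complex] at h
    show ∫ y, (𝓕⁻ χc y).re = 1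
    rw [h, ← fourier_apply_zero, hFΦ, hχc]
    simp only [smul_zero, Complex.ofReal_re]
    exact dyadicCutoff_apply_of_norm_le_one (by simp)
  · refine hΦ2.mono' ((continuous_norm.pow 2).mul (Complex.continuous_re.comp hΦc)).aestronglyMeasurable
      (Eventually.of_forall fun y => ?_)
    rw [norm_mul, norm_pow, norm_norm, Real.norm_eq_abs]
    exact mul_le_mul_of_nonneg_left (Complex.abs_re_le_norm _) (by positivity)
  · rw [hΨ, hχc, integral_norm_sq_mul_abs_re_fourierInv_dyadicCutoff_smul hc0, hM, mul_comm]
  · rw [hΨC']; exact hΦi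
  · rw [hΨC', hFΦ, hχc]
    simp only
    rw [dyadicCutoff_apply_of_two_le_norm, Complex.ofReal_zero]
    rw [norm_smul, Real.norm_eq_abs, abs_of_pos hc0, hc]
    calc (2 : ℝ) = 2 / κ * κ := by field_simp
      _ ≤ 2 / κ * ‖ξ‖ := mul_le_mul_of_nonneg_left hξ hc0.le

/-! ## The packaged low-frequency cancellation for `e^{tΔ}` -/

/-- The real convolution `f ⋆ g`, read in `ℂ`, is the convolution of the complexified
functions. [folklore] -/
theorem ofReal_convolution_lsmul (f g : E → ℝ) (x : E) :
    (((f ⋆[ContinuousLinearMap.lsmul ℝ ℝ, volume] g) x : ℝ) : ℂ) =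
      ((fun y => (f y : ℂ)) ⋆[ContinuousLinearMap.lsmul ℂ ℂ, volume] (fun y => (g y : ℂ))) x := by
  rw [convolution_lsmul, convolution_lsmul, ← integral_complex_ofReal]
  simp only [smul_eq_mul, Complex.ofReal_mul]

/-- **Low-frequency cancellation for the heat semigroup (kernel form).** There is `C = C(d)`
such that for every `κ > 0` there is `Ψ ∈ L¹(E)` with
* `𝓕(Ψ ⋆ K_t)(ξ) = 0` whenever `‖ξ‖ ≥ κ` (`t > 0`), and
* `‖K_t - Ψ ⋆ K_t‖_{L¹} ≤ C / (κ² t)` for all `t > 0`.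
Hence on functions whose Fourier transform/series lives in `{‖ξ‖ ≥ κ}` the heat semigroup
`e^{tΔ} = K_t ⋆` acts as `(K_t - Ψ ⋆ K_t) ⋆`, with operator norm `≤ C/(κ² t)` on every `L^p`.
This is the real-variable content of the bound `‖|∇|⁻¹ P_{≥κ}‖_{L^p→L^p} ≲ κ⁻¹` used by
Buckmaster–Vicol (Ann. of Math. 189 (2019), App. B, proof of Lemma B.1: "a direct consequence of
the Littlewood–Paley decomposition"), via `|∇|⁻¹ = π^{-1/2} ∫₀^∞ t^{-1/2} e^{tΔ} dt`. [folklore] -/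
theorem exists_heatKernel_lowFreq_cancellation :
    ∃ C : ℝ, 0 ≤ C ∧ ∀ κ : ℝ, 0 < κ → ∃ Ψ : E → ℝ, Integrable Ψ ∧
      (∀ t : ℝ, 0 < t → ∀ ξ : E, κ ≤ ‖ξ‖ →
        𝓕 (fun y => (((Ψ ⋆[ContinuousLinearMap.lsmul ℝ ℝ, volume] heatKernel t) y : ℝ) : ℂ)) ξ = 0) ∧
      (∀ t : ℝ, 0 < t →
        ∫⁻ x, ‖heatKernel t x - (Ψ ⋆[ContinuousLinearMap.lsmul ℝ ℝ, volume] heatKernel t) x‖ₑ ≤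
          ENNReal.ofReal (C / (κ ^ 2 * t))) := by
  obtain ⟨M, hM0, hM⟩ := exists_lowFreq_mollifier (E := E)
  refine ⟨(2 : ℝ) ^ Module.finrank ℝ E * (4 * M), by positivity, fun κ hκ => ?_⟩
  obtain ⟨Ψ, -, hΨi, hΨe, hΨ1, hΨ2, hΨM, hΨCi, hΨF⟩ := hM κ hκ
  refine ⟨Ψ, hΨi, fun t ht ξ hξ => ?_, fun t ht => ?_⟩
  · have hconv : (fun y => (((Ψ ⋆[ContinuousLinearMap.lsmul ℝ ℝ, volume] heatKernel t) y : ℝ) : ℂ)) =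
        (fun y => (Ψ y : ℂ)) ⋆[ContinuousLinearMap.lsmul ℂ ℂ, volume] (fun y => (heatKernel t y : ℂ)) :=
      funext fun y => ofReal_convolution_lsmul Ψ (heatKernel t) y
    rw [hconv, Real.fourier_smul_convolution_eq hΨCi (integrable_heatKernel_holds ht).ofReal,
      hΨF ξ hξ, zero_smul]
  · refine (lintegral_enorm_heatKernel_sub_convolution_le hΨi hΨe hΨ1 hΨ2 ht).trans
      (ENNReal.ofReal_le_ofReal ?_)
    calc (2 : ℝ) ^ Module.finrank ℝ E * t⁻¹ * ∫ y, ‖y‖ ^ 2 * |Ψ y|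
        ≤ (2 : ℝ) ^ Module.finrank ℝ E * t⁻¹ * (M * (2 / κ) ^ 2) := by gcongr
      _ = (2 : ℝ) ^ Module.finrank ℝ E * (4 * M) / (κ ^ 2 * t) := by
          field_simp
          ring

end Literature.Analysis.UnboundedOperators
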